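import Summits.Ventures.Crystal3D.Theorems.StickyWulffConstantGenericWallFloorStackLedgerOneSided
import Summits.Ventures.Crystal3D.Theorems.StickyWulffConstantGenericWallFloorStackLedgerOneSidedDown
import Summits.Ventures.Crystal3D.Theorems.StickyWulffConstantGenericWallFloorStackWalkForcedChain
import Summits.Ventures.Crystal3D.Theorems.StickyWulffConstantGenericWallFloorStackWalkWordSep
import Summits.Ventures.Crystal3D.Theorems.StickyWulffConstantGenericWallFloorStarPairFar
import Summits.Ventures.Crystal3D.Theorems.StickyWulffConstantGenericWallFloorAffineSampleDeficit
import Summits.Ventures.Crystal3D.StickySpheres.FinsetBridge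
import HarnessLib

/-!
# `GenericWallFloor` per pair AT HALF CHARGE from ONE grain's walkers: the crux's matrix with `c₀ = ½κ ≥ ½`
# for every pair one of whose grains has a steep slot whose forced rays miss the other lattice
# (crux `GenericWallFloor`, stmt-Ventures-19480, line `WallLedgerG`)

HONEST FRAMING. Venture `Summits/Ventures/Crystal3D` (cell `crystal3d-full`), helper `--supports` the crux
`GenericWallFloor` of `route-Ventures-StickyWulffConstant`, REGISTERED line `WallLedgerG`, open stub
`stub_twoSlabAdhesion`.  Rung credit only; F-C1 not moved; NOT the crux: the charge here is `½κ ∈ [½, √2/2]`, not the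
crux's `1`, and the two certified computations `ExactOnly`(C12-55) [E1] and `StarPairFar` remain inputs BY NAME.

WHAT IS HERE.
* `TwoSlabLedgerAt q A₁ t₁ A₂ t₂` — the matrix of the line's stub `TwoSlabAdhesion` for ONE pair with the unit charge
  replaced by `q` (the shape every stack ledger of the line concludes); `GenericWallFloorAtCharge c A₁ t₁ A₂ t₂` — the
  matrix of the route decl `GenericWallFloor` for one pair with `+ 1` replaced by `+ c` (so `GenericWallFloorAtCharge 1`
  is 19480-p2 g4's `GenericWallFloorAt`, definitionally); `genericWallFloorAtCharge_of_ledger` — the planner's skeleton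
  composition (`stub_affineSampleDeficit`, landed) uniform in the charge; `genericWallFloorAtCharge_mono`.
* `image_ne_of_word` — the ONE-SIDED WORD CRITERION: if the other lattice is presented over the frame `A` by a reduced
  model menu word `κ` of length `≥ 2` whose first-applied letter is ORTHOGONAL to the slot `u`, then no frame of a sound
  well-formed stack over `(A, u, 0)` (any vertical) IS that lattice (near half of `not_coaxial_of_word`, no transport).
* `genericWallFloorAtCharge_oneSided_of_far` / `…_oneSidedDown_of_far` — for EVERY pair and every steep up-slot `u₁` of
  grain 1 whose countable forced-ray frame set `chainFrames e₃ A₁ u₁` contains no frame with `A₂`'s lattice (resp. steep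
  down-slot `u₂` of grain 2, `chainFrames (−e₃) A₂ u₂` missing `A₁`'s lattice): `GenericWallFloorAtCharge (½κ)` with
  `κ = √2|⟪A u, e₃⟫| ≥ 1`, hence `GenericWallFloorAtCharge ½` (`genericWallFloorAtHalf_oneSided_of_far`, `…Down…`),
  modulo `ExactOnly`(C12-55) and `StarPairFar`; word-criterion instances `…_word_of_far` / `…_wordDown_of_far`.

WHY (numbers, seat folder `calc/onesided2.py`, 2000 Haar `Σ9` pairs): the two-sided residual-free ledger covers `39 %`
of `Σ9` orientations at full charge; the hypothesis of THIS file holds for some steep slot of SOME grain in `94 %`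
(each grain alone `88.5 %`; the simple word criterion «a steep slot in that grain's composition plane» already gives
`94 %`), i.e. on `≈ 90 %` of the ray-aligned core ONE grain's walkers still pay in full and the crux's matrix holds at
`c₀ = ½`.  The residual `6 %` = both grains' steep slots all off their composition planes AND both best-rising lamella
cappers off the far composition plane (mutual arrival).
WHAT THIS IS NOT: not `c₀ = 1` on the core (that needs two-sided charging with riser payers, 19480-p1 g6's programme);
no new computation; F-C1 not moved.
-/

noncomputable section

namespace Summit.Ventures.Crystal3D.Theorems

open Summit.Ventures.Crystal3D Finset
open Summit.Ventures.Crystal3D.Cruxes.GenericWallFloor.WallLedgerG (AffineSampleDeficit)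
open Literature.MathematicalPhysics.StatisticalMechanics (fccStacking barlowStacking IsHaggSeq contactDeficiency)
open scoped InnerProductSpace

/-! ### The two per-pair matrices, uniform in the charge -/

/-- **The line's stub `TwoSlabAdhesion` for ONE pair at charge `q`**: constants `C`, `R₀ ≥ 1`, and in every clamped
cylinder cell (hypotheses of `TwoSlabAdhesion` verbatim) `cross(P₁,X∖P₁) + cross(P₂,Y) ≤ D(Y) + (φ₁ + φ₂ − q)πρ² + C(1+h)ρ`. -/
def TwoSlabLedgerAt (q : ℝ) (A₁ : EuclideanSpace ℝ (Fin 3) ≃ₗᵢ[ℝ] EuclideanSpace ℝ (Fin 3)) (t₁ : EuclideanSpace ℝ (Fin 3))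
    (A₂ : EuclideanSpace ℝ (Fin 3) ≃ₗᵢ[ℝ] EuclideanSpace ℝ (Fin 3)) (t₂ : EuclideanSpace ℝ (Fin 3)) : Prop :=
  ∃ C R₀ : ℝ, 1 ≤ R₀ ∧ ∀ h : ℝ, 0 ≤ h → ∀ ρ : ℝ, R₀ ≤ ρ →
    ∀ X P₁ P₂ : Finset (EuclideanSpace ℝ (Fin 3)),
    (∀ p ∈ X, ∀ q ∈ X, p ≠ q → 1 ≤ dist p q) → P₁ ⊆ X → P₂ ⊆ X \ P₁ →
    (∀ p ∈ X, -(2 * R₀) ≤ p 2 ∧ p 2 ≤ h + 2 * R₀ ∧ p 0 ^ 2 + p 1 ^ 2 ≤ ρ ^ 2) →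
    (∀ p, p ∈ P₁ ↔ (p ∈ (fun q => A₁ q + t₁) '' fccStacking 1 (Real.sqrt (2 / 3)) ∧
      -(2 * R₀) ≤ p 2 ∧ p 2 ≤ -R₀ ∧ p 0 ^ 2 + p 1 ^ 2 ≤ ρ ^ 2)) →
    (∀ p, p ∈ P₂ ↔ (p ∈ (fun q => A₂ q + t₂) '' fccStacking 1 (Real.sqrt (2 / 3)) ∧
      h + R₀ ≤ p 2 ∧ p 2 ≤ h + 2 * R₀ ∧ p 0 ^ 2 + p 1 ^ 2 ≤ ρ ^ 2)) →
    ((((P₁ ×ˢ (X \ P₁)).filter fun pq => dist pq.1 pq.2 = 1).card : ℕ) : ℝ) +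
      ((((P₂ ×ˢ ((X \ P₁) \ P₂)).filter fun pq => dist pq.1 pq.2 = 1).card : ℕ) : ℝ) ≤
      contactDeficiency ((X \ P₁) \ P₂) +
        (Real.sqrt 2 / 4 * ∑ᶠ w ∈ {w ∈ fccStacking 1 (Real.sqrt (2 / 3)) | ‖w‖ = 1},
            |⟪w, A₁.symm (EuclideanSpace.single (2 : Fin 3) (1 : ℝ))⟫_ℝ| +
          Real.sqrt 2 / 4 * ∑ᶠ w ∈ {w ∈ fccStacking 1 (Real.sqrt (2 / 3)) | ‖w‖ = 1},
            |⟪w, A₂.symm (EuclideanSpace.single (2 : Fin 3) (1 : ℝ))⟫_ℝ| - q) * Real.pi * ρ ^ 2 +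
        C * (1 + h) * ρ

/-- **The route decl `GenericWallFloor` for ONE pair at charge `c`**: its matrix verbatim with the unit charge `+ 1`
replaced by `+ c` (`GenericWallFloorAtCharge 1` is `GenericWallFloorAt`, by `rfl`). -/
def GenericWallFloorAtCharge (c : ℝ) (A₁ : EuclideanSpace ℝ (Fin 3) ≃ₗᵢ[ℝ] EuclideanSpace ℝ (Fin 3))
    (t₁ : EuclideanSpace ℝ (Fin 3)) (A₂ : EuclideanSpace ℝ (Fin 3) ≃ₗᵢ[ℝ] EuclideanSpace ℝ (Fin 3))
    (t₂ : EuclideanSpace ℝ (Fin 3)) : Prop :=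
  ∃ C R₀ : ℝ, 0 < R₀ ∧ ∀ h : ℝ, 0 ≤ h → ∀ ρ : ℝ, R₀ ≤ ρ → ∀ (N : ℕ) (x : Fin N → EuclideanSpace ℝ (Fin 3)),
    Summit.Ventures.Crystal3D.IsUnitPacking x → (∀ i, -(2 * R₀) ≤ x i 2 ∧ x i 2 ≤ h + 2 * R₀ ∧ x i 0 ^ 2 + x i 1 ^ 2 ≤ ρ ^ 2) →
    (∀ p ∈ (fun p => A₁ p + t₁) '' fccStacking 1 (Real.sqrt (2 / 3)),
      (-(2 * R₀) ≤ p 2 ∧ p 2 ≤ -R₀ ∧ p 0 ^ 2 + p 1 ^ 2 ≤ ρ ^ 2) → ∃ i, x i = p) →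
    (∀ p ∈ (fun p => A₂ p + t₂) '' fccStacking 1 (Real.sqrt (2 / 3)),
      (h + R₀ ≤ p 2 ∧ p 2 ≤ h + 2 * R₀ ∧ p 0 ^ 2 + p 1 ^ 2 ≤ ρ ^ 2) → ∃ i, x i = p) →
    (Real.sqrt 2 / 4 * ∑ᶠ w ∈ {w ∈ fccStacking 1 (Real.sqrt (2 / 3)) | ‖w‖ = 1},
        |⟪w, A₁.symm (EuclideanSpace.single (2 : Fin 3) (1 : ℝ))⟫_ℝ| +
      Real.sqrt 2 / 4 * ∑ᶠ w ∈ {w ∈ fccStacking 1 (Real.sqrt (2 / 3)) | ‖w‖ = 1},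
        |⟪w, A₂.symm (EuclideanSpace.single (2 : Fin 3) (1 : ℝ))⟫_ℝ| + c) * Real.pi * ρ ^ 2 - C * (1 + h) * ρ ≤
      6 * (N : ℝ) - (Summit.Ventures.Crystal3D.numContacts x : ℝ)

/-- Lowering the charge only weakens the per-pair statement. -/
theorem genericWallFloorAtCharge_mono {c c' : ℝ} (hcc : c ≤ c')
    {A₁ : EuclideanSpace ℝ (Fin 3) ≃ₗᵢ[ℝ] EuclideanSpace ℝ (Fin 3)} {t₁ : EuclideanSpace ℝ (Fin 3)}
    {A₂ : EuclideanSpace ℝ (Fin 3) ≃ₗᵢ[ℝ] EuclideanSpace ℝ (Fin 3)} {t₂ : EuclideanSpace ℝ (Fin 3)}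
    (h : GenericWallFloorAtCharge c' A₁ t₁ A₂ t₂) : GenericWallFloorAtCharge c A₁ t₁ A₂ t₂ := by
  obtain ⟨C, R₀, hR₀, hall⟩ := h
  refine ⟨C, R₀, hR₀, fun h hh ρ hρ N x hx hcyl hs₁ hs₂ => ?_⟩
  have hmain := hall h hh ρ hρ N x hx hcyl hs₁ hs₂
  have hπρ : 0 ≤ Real.pi * ρ ^ 2 := by positivity
  nlinarith only [hmain, hπρ, hcc]

open scoped Classical in
/-- **The skeleton composition per pair, uniform in the charge.**  The landed `stub_affineSampleDeficit` and a two-slab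
ledger at charge `q` give the crux's matrix at charge `q` for the pair (the planner's `GenericWallFloor_holds_of_stubs`,
one pair at a time, `1 ↦ q`). -/
theorem genericWallFloorAtCharge_of_ledger (q : ℝ)
    (A₁ : EuclideanSpace ℝ (Fin 3) ≃ₗᵢ[ℝ] EuclideanSpace ℝ (Fin 3)) (t₁ : EuclideanSpace ℝ (Fin 3))
    (A₂ : EuclideanSpace ℝ (Fin 3) ≃ₗᵢ[ℝ] EuclideanSpace ℝ (Fin 3)) (t₂ : EuclideanSpace ℝ (Fin 3))
    (hled : TwoSlabLedgerAt q A₁ t₁ A₂ t₂) : GenericWallFloorAtCharge q A₁ t₁ A₂ t₂ := by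
  classical
  have hS : AffineSampleDeficit := stub_affineSampleDeficit
  obtain ⟨C, R₀, hR₀, hadh⟩ := hled
  obtain ⟨C₁, hC₁⟩ := hS A₁ t₁ R₀ hR₀
  obtain ⟨C₂, hC₂⟩ := hS A₂ t₂ R₀ hR₀
  refine ⟨|C| + |C₁| + |C₂|, R₀, by linarith, ?_⟩
  intro h hh ρ hρ N x hx hcyl hslab₁ hslab₂
  -- the packing as a finite set, the two samples as filters
  have hxinj : Function.Injective x := hx.injective
  set X : Finset (EuclideanSpace ℝ (Fin 3)) := univ.image x with hX
  set P₁ : Finset (EuclideanSpace ℝ (Fin 3)) := X.filter fun p =>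
    p ∈ (fun q => A₁ q + t₁) '' fccStacking 1 (Real.sqrt (2 / 3)) ∧
      -(2 * R₀) ≤ p 2 ∧ p 2 ≤ -R₀ ∧ p 0 ^ 2 + p 1 ^ 2 ≤ ρ ^ 2 with hP₁
  set P₂ : Finset (EuclideanSpace ℝ (Fin 3)) := (X \ P₁).filter fun p =>
    p ∈ (fun q => A₂ q + t₂) '' fccStacking 1 (Real.sqrt (2 / 3)) ∧
      h + R₀ ≤ p 2 ∧ p 2 ≤ h + 2 * R₀ ∧ p 0 ^ 2 + p 1 ^ 2 ≤ ρ ^ 2 with hP₂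
  have hXpack : ∀ p ∈ X, ∀ q ∈ X, p ≠ q → 1 ≤ dist p q := by
    intro p hp q hq hpq
    obtain ⟨i, -, rfl⟩ := mem_image.1 hp
    obtain ⟨j, -, rfl⟩ := mem_image.1 hq
    exact hx.one_le_dist fun hij => hpq (by rw [hij])
  have hP₁X : P₁ ⊆ X := filter_subset _ _
  have hP₂X : P₂ ⊆ X \ P₁ := filter_subset _ _
  have hXcyl : ∀ p ∈ X, -(2 * R₀) ≤ p 2 ∧ p 2 ≤ h + 2 * R₀ ∧ p 0 ^ 2 + p 1 ^ 2 ≤ ρ ^ 2 := by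
    intro p hp
    obtain ⟨i, -, rfl⟩ := mem_image.1 hp
    exact hcyl i
  have hP₁iff : ∀ p, p ∈ P₁ ↔ (p ∈ (fun q => A₁ q + t₁) '' fccStacking 1 (Real.sqrt (2 / 3)) ∧
      -(2 * R₀) ≤ p 2 ∧ p 2 ≤ -R₀ ∧ p 0 ^ 2 + p 1 ^ 2 ≤ ρ ^ 2) := by
    intro p
    rw [hP₁, mem_filter]
    refine ⟨fun hp => hp.2, fun hp => ⟨?_, hp⟩⟩
    obtain ⟨i, hi⟩ := hslab₁ p hp.1 ⟨hp.2.1, hp.2.2.1, hp.2.2.2⟩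
    exact mem_image.2 ⟨i, mem_univ _, hi⟩
  have hP₂iff : ∀ p, p ∈ P₂ ↔ (p ∈ (fun q => A₂ q + t₂) '' fccStacking 1 (Real.sqrt (2 / 3)) ∧
      h + R₀ ≤ p 2 ∧ p 2 ≤ h + 2 * R₀ ∧ p 0 ^ 2 + p 1 ^ 2 ≤ ρ ^ 2) := by
    intro p
    rw [hP₂, mem_filter]
    refine ⟨fun hp => hp.2, fun hp => ⟨?_, hp⟩⟩
    obtain ⟨i, hi⟩ := hslab₂ p hp.1 ⟨hp.2.1, hp.2.2.1, hp.2.2.2⟩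
    rw [mem_sdiff]
    refine ⟨mem_image.2 ⟨i, mem_univ _, hi⟩, fun hp1 => ?_⟩
    have h1 := ((hP₁iff p).1 hp1).2.2.1
    have h2 := hp.2.1
    linarith
  -- the three inequalities and the two splits
  have hadh' := hadh h hh ρ hρ X P₁ P₂ hXpack hP₁X hP₂X hXcyl hP₁iff hP₂iff
  have hD₁ := hC₁ (-(2 * R₀)) (-R₀) (by ring) ρ hρ P₁ hP₁iff
  have hD₂ := hC₂ (h + R₀) (h + 2 * R₀) (by ring) ρ hρ P₂ hP₂iff
  have hsplit₁ := contactDeficiency_sdiff_split hP₁X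
  have hsplit₂ := contactDeficiency_sdiff_split hP₂X
  have hDX : contactDeficiency X = 6 * (N : ℝ) - (numContacts x : ℝ) :=
    contactDeficiency_image_eq x hxinj
  rw [← hDX]
  have hρ0 : (0 : ℝ) ≤ ρ := by linarith
  have h1h : (0 : ℝ) ≤ (1 + h) * ρ := by positivity
  have ha : C * (1 + h) * ρ ≤ |C| * (1 + h) * ρ := by
    have h1 : 0 ≤ (|C| - C) * ((1 + h) * ρ) := mul_nonneg (by linarith only [le_abs_self C]) h1h
    linarith only [h1]
  have hb : C₁ * ρ ≤ |C₁| * (1 + h) * ρ := by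
    have h1 : 0 ≤ (|C₁| - C₁) * ρ := mul_nonneg (by linarith only [le_abs_self C₁]) hρ0
    have h2 : 0 ≤ |C₁| * h * ρ := by positivity
    linarith only [h1, h2]
  have hc : C₂ * ρ ≤ |C₂| * (1 + h) * ρ := by
    have h1 : 0 ≤ (|C₂| - C₂) * ρ := mul_nonneg (by linarith only [le_abs_self C₂]) hρ0
    have h2 : 0 ≤ |C₂| * h * ρ := by positivity
    linarith only [h1, h2]
  linarith only [hadh', hD₁, hD₂, hsplit₁, hsplit₂, ha, hb, hc]

/-- Steep slots carry flux `κ = √2|⟪A u, e₃⟫| ≥ 1`. -/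
theorem one_le_flux_of_steep {A : EuclideanSpace ℝ (Fin 3) ≃ₗᵢ[ℝ] EuclideanSpace ℝ (Fin 3)} {u : EuclideanSpace ℝ (Fin 3)}
    (hsteep : Real.sqrt 2 / 2 ≤ |⟪A u, EuclideanSpace.single (2 : Fin 3) (1 : ℝ)⟫_ℝ|) :
    1 ≤ Real.sqrt 2 * |⟪A u, EuclideanSpace.single (2 : Fin 3) (1 : ℝ)⟫_ℝ| := by
  have hs2 : Real.sqrt 2 * (Real.sqrt 2 / 2) = 1 := by
    rw [← mul_div_assoc, Real.mul_self_sqrt (by norm_num : (0 : ℝ) ≤ 2)]; norm_num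
  calc (1 : ℝ) = Real.sqrt 2 * (Real.sqrt 2 / 2) := hs2.symm
    _ ≤ _ := mul_le_mul_of_nonneg_left hsteep (Real.sqrt_nonneg 2)

/-! ### The one-sided word criterion -/

/-- **One-sided word criterion.**  Let the lattice of `B` be presented over the frame `A` by a reduced model menu word
`κ` of length `≥ 2` (`B·Λ₀ = (wordFrame A κ)·Λ₀`; unit model `{111}` normals, consecutive letters at `±1/3`) whose
first-applied (last) letter `μ` is ORTHOGONAL to the slot `u` (`⟪u, μ⟫ = 0`: `u` lies in the first mirror plane).
Then no frame of a sound well-formed stack over the bottom `(A, u, 0)` (any vertical `z`) IS that lattice.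
Mechanism: the frame is `wordFrame A α` for the stack word `α`, whose last letter is POSITIVE on `u`
(`inner_dir_getLast_stackWord`) unless `α = []`; equal slot dozens force equal mirror sequences
(`map_reflection_eq_of_image_eq`), and the two last letters cannot agree (`false_of_map_reflection_eq`). -/
theorem image_ne_of_word {A B : EuclideanSpace ℝ (Fin 3) ≃ₗᵢ[ℝ] EuclideanSpace ℝ (Fin 3)} {u : EuclideanSpace ℝ (Fin 3)}
    (κ : List (EuclideanSpace ℝ (Fin 3)))
    (hκl : ∀ μ ∈ κ, ‖μ‖ = 1 ∧
      ∀ w ∈ fccSlots, ⟪w, μ⟫_ℝ = 0 ∨ ⟪w, μ⟫_ℝ = Real.sqrt (2 / 3) ∨ ⟪w, μ⟫_ℝ = -Real.sqrt (2 / 3))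
    (hκc : List.IsChain (fun μ μ' => ⟪μ, μ'⟫_ℝ = 1 / 3 ∨ ⟪μ, μ'⟫_ℝ = -1 / 3) κ) (hκ2 : 2 ≤ κ.length)
    (hB : B '' fccStacking 1 (Real.sqrt (2 / 3)) = (wordFrame A κ) '' fccStacking 1 (Real.sqrt (2 / 3)))
    (hfirst : ∀ μ, κ.getLast? = some μ → ⟪u, μ⟫_ℝ = 0)
    {z : EuclideanSpace ℝ (Fin 3)} {stk : List WalkEntry}
    (hS : StackSound z stk) (hW : StackWF z stk) (hl : stk.getLast? = some ⟨A, u, 0⟩)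
    {e : WalkEntry} (he : e ∈ stk) :
    e.frame '' fccStacking 1 (Real.sqrt (2 / 3)) ≠ B '' fccStacking 1 (Real.sqrt (2 / 3)) := by
  intro hEq
  obtain ⟨r, hS', hW', hl'⟩ := exists_suffix_of_mem stk e he hS hW
  rw [hl] at hl'
  obtain ⟨hαl, hαc⟩ := stackWord_letters _ hS' hW'
  have hF : e.frame = wordFrame A (stackWord (e :: r)) := by
    rw [frame_eq_wordFrame e r hS', stackBase_eq_of_getLast? hl']
  have hαpos : ∀ μ, (stackWord (e :: r)).getLast? = some μ → ⟪u, μ⟫_ℝ = Real.sqrt (2 / 3) :=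
    fun μ hμ => inner_dir_getLast_stackWord r e ⟨A, u, 0⟩ hS' hl' μ hμ
  have himg := image_fccSlots_eq_of_image_fcc_eq _ _ (hEq.trans hB)
  rw [hF] at himg
  have hκlast : ∃ μ, κ.getLast? = some μ ∧ ⟪u, μ⟫_ℝ = 0 := by
    have hκne : κ ≠ [] := by rintro rfl; simp at hκ2
    obtain ⟨μ, hμ⟩ := Option.ne_none_iff_exists'.1 (mt List.getLast?_eq_none_iff.1 hκne)
    exact ⟨μ, hμ, hfirst μ hμ⟩
  exact false_of_map_reflection_eq (fun μ hμ => (hαl μ hμ).1) (fun μ hμ => (hκl μ hμ).1)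
    (length_le_one_or_getLast_pos _ hαpos) hκ2 hκlast (map_reflection_eq_of_image_eq A hαl hαc hκl hκc himg)

/-! ### Grain 1 alone -/

open scoped Classical in
/-- **`GenericWallFloor` per pair at charge `½κ₁` from grain 1 alone**, modulo `ExactOnly`(C12-55) and the certified
`StarPairFar`: for every pair, every steep up-slot `u₁` of grain 1 and every frame set `M₁` containing the frames of
all sound well-formed stacks over `(A₁, u₁, 0)` and no frame with `A₂`'s lattice. -/
theorem genericWallFloorAtCharge_oneSided_of_far
    {s₀ : EuclideanSpace ℝ (Fin 3)} (hs₀ : s₀ ∈ fccSlots)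
    (hcert : ExactOnly 0 (fccSlots.filter fun w => 0 < ⟪w, s₀⟫_ℝ)) (hfar : StarPairFar)
    (A₁ : EuclideanSpace ℝ (Fin 3) ≃ₗᵢ[ℝ] EuclideanSpace ℝ (Fin 3)) (t₁ : EuclideanSpace ℝ (Fin 3))
    (A₂ : EuclideanSpace ℝ (Fin 3) ≃ₗᵢ[ℝ] EuclideanSpace ℝ (Fin 3)) (t₂ : EuclideanSpace ℝ (Fin 3))
    {u₁ : EuclideanSpace ℝ (Fin 3)} (hu₁ : u₁ ∈ fccSlots)
    (hsteep₁ : Real.sqrt 2 / 2 ≤ ⟪A₁ u₁, EuclideanSpace.single (2 : Fin 3) (1 : ℝ)⟫_ℝ)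
    (M₁ : Set (EuclideanSpace ℝ (Fin 3) ≃ₗᵢ[ℝ] EuclideanSpace ℝ (Fin 3)))
    (hM₁ : ∀ stk : List WalkEntry, StackSound (EuclideanSpace.single (2 : Fin 3) (1 : ℝ)) stk →
      StackWF (EuclideanSpace.single (2 : Fin 3) (1 : ℝ)) stk → stk.getLast? = some ⟨A₁, u₁, 0⟩ →
      ∀ e ∈ stk, e.frame ∈ M₁)
    (hmiss : ∀ F ∈ M₁, F '' fccStacking 1 (Real.sqrt (2 / 3)) ≠ A₂ '' fccStacking 1 (Real.sqrt (2 / 3))) :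
    GenericWallFloorAtCharge (Real.sqrt 2 * |⟪A₁ u₁, EuclideanSpace.single (2 : Fin 3) (1 : ℝ)⟫_ℝ| / 2) A₁ t₁ A₂ t₂ :=
  genericWallFloorAtCharge_of_ledger _ A₁ t₁ A₂ t₂
    (twoSlabAdhesion_stackLedger_oneSided hs₀ hcert (doubleStarCoaxialAt_of_starPairFar hfar)
      (capPairCoaxial_of_starPairFar hfar) A₁ t₁ A₂ t₂ hu₁ hsteep₁ M₁ hM₁ hmiss)

open scoped Classical in
/-- **Half charge from grain 1 alone** (`½κ₁ ≥ ½` at a steep slot): `GenericWallFloorAtCharge ½` under the hypotheses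
of `genericWallFloorAtCharge_oneSided_of_far`. -/
theorem genericWallFloorAtHalf_oneSided_of_far
    {s₀ : EuclideanSpace ℝ (Fin 3)} (hs₀ : s₀ ∈ fccSlots)
    (hcert : ExactOnly 0 (fccSlots.filter fun w => 0 < ⟪w, s₀⟫_ℝ)) (hfar : StarPairFar)
    (A₁ : EuclideanSpace ℝ (Fin 3) ≃ₗᵢ[ℝ] EuclideanSpace ℝ (Fin 3)) (t₁ : EuclideanSpace ℝ (Fin 3))
    (A₂ : EuclideanSpace ℝ (Fin 3) ≃ₗᵢ[ℝ] EuclideanSpace ℝ (Fin 3)) (t₂ : EuclideanSpace ℝ (Fin 3))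
    {u₁ : EuclideanSpace ℝ (Fin 3)} (hu₁ : u₁ ∈ fccSlots)
    (hsteep₁ : Real.sqrt 2 / 2 ≤ ⟪A₁ u₁, EuclideanSpace.single (2 : Fin 3) (1 : ℝ)⟫_ℝ)
    (M₁ : Set (EuclideanSpace ℝ (Fin 3) ≃ₗᵢ[ℝ] EuclideanSpace ℝ (Fin 3)))
    (hM₁ : ∀ stk : List WalkEntry, StackSound (EuclideanSpace.single (2 : Fin 3) (1 : ℝ)) stk →
      StackWF (EuclideanSpace.single (2 : Fin 3) (1 : ℝ)) stk → stk.getLast? = some ⟨A₁, u₁, 0⟩ →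
      ∀ e ∈ stk, e.frame ∈ M₁)
    (hmiss : ∀ F ∈ M₁, F '' fccStacking 1 (Real.sqrt (2 / 3)) ≠ A₂ '' fccStacking 1 (Real.sqrt (2 / 3))) :
    GenericWallFloorAtCharge (1 / 2) A₁ t₁ A₂ t₂ := by
  have hκ := one_le_flux_of_steep (A := A₁) (u := u₁) (le_trans hsteep₁ (le_abs_self _))
  exact genericWallFloorAtCharge_mono (by linarith only [hκ])
    (genericWallFloorAtCharge_oneSided_of_far hs₀ hcert hfar A₁ t₁ A₂ t₂ hu₁ hsteep₁ M₁ hM₁ hmiss)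

open scoped Classical in
/-- **Half charge from grain 1 over its FORCED RAYS**: the countable frame set `chainFrames e₃ A₁ u₁` (the base frame
and the two forced rays of the steep up-slot `u₁`) misses `A₂`'s lattice; modulo `ExactOnly`(C12-55) and `StarPairFar`.
(On a `Σ9` pair: `u₁` in the near composition plane, or the best-rising lamella capper in the far one.) -/
theorem genericWallFloorAtHalf_chain_of_far
    {s₀ : EuclideanSpace ℝ (Fin 3)} (hs₀ : s₀ ∈ fccSlots)
    (hcert : ExactOnly 0 (fccSlots.filter fun w => 0 < ⟪w, s₀⟫_ℝ)) (hfar : StarPairFar)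
    (A₁ : EuclideanSpace ℝ (Fin 3) ≃ₗᵢ[ℝ] EuclideanSpace ℝ (Fin 3)) (t₁ : EuclideanSpace ℝ (Fin 3))
    (A₂ : EuclideanSpace ℝ (Fin 3) ≃ₗᵢ[ℝ] EuclideanSpace ℝ (Fin 3)) (t₂ : EuclideanSpace ℝ (Fin 3))
    {u₁ : EuclideanSpace ℝ (Fin 3)} (hu₁ : u₁ ∈ fccSlots)
    (hsteep₁ : Real.sqrt 2 / 2 ≤ ⟪A₁ u₁, EuclideanSpace.single (2 : Fin 3) (1 : ℝ)⟫_ℝ)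
    (hmiss : ∀ F ∈ chainFrames (EuclideanSpace.single (2 : Fin 3) (1 : ℝ)) A₁ u₁,
      F '' fccStacking 1 (Real.sqrt (2 / 3)) ≠ A₂ '' fccStacking 1 (Real.sqrt (2 / 3))) :
    GenericWallFloorAtCharge (1 / 2) A₁ t₁ A₂ t₂ :=
  genericWallFloorAtHalf_oneSided_of_far hs₀ hcert hfar A₁ t₁ A₂ t₂ hu₁ hsteep₁ _
    (fun _ hS hW hlast => frame_mem_chainFrames_of_stack hS hW hlast) hmiss

open scoped Classical in
/-- **Half charge from grain 1 under the one-sided WORD CRITERION**: `A₂·Λ₀ = (wordFrame A₁ κ)·Λ₀` for a reduced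
model menu word `κ`, `|κ| ≥ 2`, and a steep up-slot `u₁` IN the first mirror plane (`⟪u₁, μ⟫ = 0` for the last letter
`μ`); modulo `ExactOnly`(C12-55) and `StarPairFar`.  (Numerically `66 %` of `Σ9` orientations per grain.) -/
theorem genericWallFloorAtHalf_word_of_far
    {s₀ : EuclideanSpace ℝ (Fin 3)} (hs₀ : s₀ ∈ fccSlots)
    (hcert : ExactOnly 0 (fccSlots.filter fun w => 0 < ⟪w, s₀⟫_ℝ)) (hfar : StarPairFar)
    (A₁ : EuclideanSpace ℝ (Fin 3) ≃ₗᵢ[ℝ] EuclideanSpace ℝ (Fin 3)) (t₁ : EuclideanSpace ℝ (Fin 3))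
    (A₂ : EuclideanSpace ℝ (Fin 3) ≃ₗᵢ[ℝ] EuclideanSpace ℝ (Fin 3)) (t₂ : EuclideanSpace ℝ (Fin 3))
    {u₁ : EuclideanSpace ℝ (Fin 3)} (hu₁ : u₁ ∈ fccSlots)
    (hsteep₁ : Real.sqrt 2 / 2 ≤ ⟪A₁ u₁, EuclideanSpace.single (2 : Fin 3) (1 : ℝ)⟫_ℝ)
    (κ : List (EuclideanSpace ℝ (Fin 3)))
    (hκl : ∀ μ ∈ κ, ‖μ‖ = 1 ∧
      ∀ w ∈ fccSlots, ⟪w, μ⟫_ℝ = 0 ∨ ⟪w, μ⟫_ℝ = Real.sqrt (2 / 3) ∨ ⟪w, μ⟫_ℝ = -Real.sqrt (2 / 3))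
    (hκc : List.IsChain (fun μ μ' => ⟪μ, μ'⟫_ℝ = 1 / 3 ∨ ⟪μ, μ'⟫_ℝ = -1 / 3) κ) (hκ2 : 2 ≤ κ.length)
    (hA₂ : A₂ '' fccStacking 1 (Real.sqrt (2 / 3)) = (wordFrame A₁ κ) '' fccStacking 1 (Real.sqrt (2 / 3)))
    (hfirst : ∀ μ, κ.getLast? = some μ → ⟪u₁, μ⟫_ℝ = 0) :
    GenericWallFloorAtCharge (1 / 2) A₁ t₁ A₂ t₂ :=
  genericWallFloorAtHalf_oneSided_of_far hs₀ hcert hfar A₁ t₁ A₂ t₂ hu₁ hsteep₁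
    {F | ∃ stk : List WalkEntry, StackSound (EuclideanSpace.single (2 : Fin 3) (1 : ℝ)) stk ∧
      StackWF (EuclideanSpace.single (2 : Fin 3) (1 : ℝ)) stk ∧ stk.getLast? = some ⟨A₁, u₁, 0⟩ ∧ ∃ e ∈ stk, e.frame = F}
    (fun stk hS hW hlast e he => ⟨stk, hS, hW, hlast, e, he, rfl⟩)
    (fun _ ⟨_, hS, hW, hl, _, he, hF⟩ => by rw [← hF]; exact image_ne_of_word κ hκl hκc hκ2 hA₂ hfirst hS hW hl he)

/-! ### Grain 2 alone -/

open scoped Classical in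
/-- **`GenericWallFloor` per pair at charge `½κ₂` from grain 2 alone**, modulo `ExactOnly`(C12-55) and `StarPairFar`:
every steep down-slot `u₂` of grain 2 and frame set `M₂ ∋` the frames of all sound well-formed stacks over `(A₂, u₂, 0)`
(vertical `−e₃`) with no frame having `A₁`'s lattice. -/
theorem genericWallFloorAtCharge_oneSidedDown_of_far
    {s₀ : EuclideanSpace ℝ (Fin 3)} (hs₀ : s₀ ∈ fccSlots)
    (hcert : ExactOnly 0 (fccSlots.filter fun w => 0 < ⟪w, s₀⟫_ℝ)) (hfar : StarPairFar)
    (A₁ : EuclideanSpace ℝ (Fin 3) ≃ₗᵢ[ℝ] EuclideanSpace ℝ (Fin 3)) (t₁ : EuclideanSpace ℝ (Fin 3))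
    (A₂ : EuclideanSpace ℝ (Fin 3) ≃ₗᵢ[ℝ] EuclideanSpace ℝ (Fin 3)) (t₂ : EuclideanSpace ℝ (Fin 3))
    {u₂ : EuclideanSpace ℝ (Fin 3)} (hu₂ : u₂ ∈ fccSlots)
    (hsteep₂ : ⟪A₂ u₂, EuclideanSpace.single (2 : Fin 3) (1 : ℝ)⟫_ℝ ≤ -(Real.sqrt 2 / 2))
    (M₂ : Set (EuclideanSpace ℝ (Fin 3) ≃ₗᵢ[ℝ] EuclideanSpace ℝ (Fin 3)))
    (hM₂ : ∀ stk : List WalkEntry, StackSound (-EuclideanSpace.single (2 : Fin 3) (1 : ℝ)) stk →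
      StackWF (-EuclideanSpace.single (2 : Fin 3) (1 : ℝ)) stk → stk.getLast? = some ⟨A₂, u₂, 0⟩ →
      ∀ e ∈ stk, e.frame ∈ M₂)
    (hmiss : ∀ F ∈ M₂, F '' fccStacking 1 (Real.sqrt (2 / 3)) ≠ A₁ '' fccStacking 1 (Real.sqrt (2 / 3))) :
    GenericWallFloorAtCharge (Real.sqrt 2 * |⟪A₂ u₂, EuclideanSpace.single (2 : Fin 3) (1 : ℝ)⟫_ℝ| / 2) A₁ t₁ A₂ t₂ :=
  genericWallFloorAtCharge_of_ledger _ A₁ t₁ A₂ t₂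
    (twoSlabAdhesion_stackLedger_oneSidedDown hs₀ hcert (doubleStarCoaxialAt_of_starPairFar hfar)
      (capPairCoaxial_of_starPairFar hfar) A₁ t₁ A₂ t₂ hu₂ hsteep₂ M₂ hM₂ hmiss)

open scoped Classical in
/-- **Half charge from grain 2 alone** (`½κ₂ ≥ ½` at a steep down-slot). -/
theorem genericWallFloorAtHalf_oneSidedDown_of_far
    {s₀ : EuclideanSpace ℝ (Fin 3)} (hs₀ : s₀ ∈ fccSlots)
    (hcert : ExactOnly 0 (fccSlots.filter fun w => 0 < ⟪w, s₀⟫_ℝ)) (hfar : StarPairFar)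
    (A₁ : EuclideanSpace ℝ (Fin 3) ≃ₗᵢ[ℝ] EuclideanSpace ℝ (Fin 3)) (t₁ : EuclideanSpace ℝ (Fin 3))
    (A₂ : EuclideanSpace ℝ (Fin 3) ≃ₗᵢ[ℝ] EuclideanSpace ℝ (Fin 3)) (t₂ : EuclideanSpace ℝ (Fin 3))
    {u₂ : EuclideanSpace ℝ (Fin 3)} (hu₂ : u₂ ∈ fccSlots)
    (hsteep₂ : ⟪A₂ u₂, EuclideanSpace.single (2 : Fin 3) (1 : ℝ)⟫_ℝ ≤ -(Real.sqrt 2 / 2))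
    (M₂ : Set (EuclideanSpace ℝ (Fin 3) ≃ₗᵢ[ℝ] EuclideanSpace ℝ (Fin 3)))
    (hM₂ : ∀ stk : List WalkEntry, StackSound (-EuclideanSpace.single (2 : Fin 3) (1 : ℝ)) stk →
      StackWF (-EuclideanSpace.single (2 : Fin 3) (1 : ℝ)) stk → stk.getLast? = some ⟨A₂, u₂, 0⟩ →
      ∀ e ∈ stk, e.frame ∈ M₂)
    (hmiss : ∀ F ∈ M₂, F '' fccStacking 1 (Real.sqrt (2 / 3)) ≠ A₁ '' fccStacking 1 (Real.sqrt (2 / 3))) :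
    GenericWallFloorAtCharge (1 / 2) A₁ t₁ A₂ t₂ := by
  have h1 : Real.sqrt 2 / 2 ≤ |⟪A₂ u₂, EuclideanSpace.single (2 : Fin 3) (1 : ℝ)⟫_ℝ| := by
    rw [abs_of_nonpos (by linarith only [hsteep₂, Real.sqrt_nonneg 2] :
      ⟪A₂ u₂, EuclideanSpace.single (2 : Fin 3) (1 : ℝ)⟫_ℝ ≤ 0)]
    linarith only [hsteep₂]
  have hκ := one_le_flux_of_steep (A := A₂) (u := u₂) h1
  exact genericWallFloorAtCharge_mono (by linarith only [hκ])
    (genericWallFloorAtCharge_oneSidedDown_of_far hs₀ hcert hfar A₁ t₁ A₂ t₂ hu₂ hsteep₂ M₂ hM₂ hmiss)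

open scoped Classical in
/-- **Half charge from grain 2 over its FORCED RAYS** (`chainFrames (−e₃) A₂ u₂` misses `A₁`'s lattice). -/
theorem genericWallFloorAtHalf_chainDown_of_far
    {s₀ : EuclideanSpace ℝ (Fin 3)} (hs₀ : s₀ ∈ fccSlots)
    (hcert : ExactOnly 0 (fccSlots.filter fun w => 0 < ⟪w, s₀⟫_ℝ)) (hfar : StarPairFar)
    (A₁ : EuclideanSpace ℝ (Fin 3) ≃ₗᵢ[ℝ] EuclideanSpace ℝ (Fin 3)) (t₁ : EuclideanSpace ℝ (Fin 3))
    (A₂ : EuclideanSpace ℝ (Fin 3) ≃ₗᵢ[ℝ] EuclideanSpace ℝ (Fin 3)) (t₂ : EuclideanSpace ℝ (Fin 3))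
    {u₂ : EuclideanSpace ℝ (Fin 3)} (hu₂ : u₂ ∈ fccSlots)
    (hsteep₂ : ⟪A₂ u₂, EuclideanSpace.single (2 : Fin 3) (1 : ℝ)⟫_ℝ ≤ -(Real.sqrt 2 / 2))
    (hmiss : ∀ F ∈ chainFrames (-EuclideanSpace.single (2 : Fin 3) (1 : ℝ)) A₂ u₂,
      F '' fccStacking 1 (Real.sqrt (2 / 3)) ≠ A₁ '' fccStacking 1 (Real.sqrt (2 / 3))) :
    GenericWallFloorAtCharge (1 / 2) A₁ t₁ A₂ t₂ :=
  genericWallFloorAtHalf_oneSidedDown_of_far hs₀ hcert hfar A₁ t₁ A₂ t₂ hu₂ hsteep₂ _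
    (fun _ hS hW hlast => frame_mem_chainFrames_of_stack hS hW hlast) hmiss

open scoped Classical in
/-- **Half charge from grain 2 under the one-sided WORD CRITERION**: `A₁·Λ₀ = (wordFrame A₂ κ)·Λ₀` for a reduced model
menu word `κ`, `|κ| ≥ 2`, and a steep down-slot `u₂` IN its first mirror plane (`⟪u₂, μ⟫ = 0` for the last letter
`μ` — the far composition plane); modulo `ExactOnly`(C12-55) and `StarPairFar`. -/
theorem genericWallFloorAtHalf_wordDown_of_far
    {s₀ : EuclideanSpace ℝ (Fin 3)} (hs₀ : s₀ ∈ fccSlots)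
    (hcert : ExactOnly 0 (fccSlots.filter fun w => 0 < ⟪w, s₀⟫_ℝ)) (hfar : StarPairFar)
    (A₁ : EuclideanSpace ℝ (Fin 3) ≃ₗᵢ[ℝ] EuclideanSpace ℝ (Fin 3)) (t₁ : EuclideanSpace ℝ (Fin 3))
    (A₂ : EuclideanSpace ℝ (Fin 3) ≃ₗᵢ[ℝ] EuclideanSpace ℝ (Fin 3)) (t₂ : EuclideanSpace ℝ (Fin 3))
    {u₂ : EuclideanSpace ℝ (Fin 3)} (hu₂ : u₂ ∈ fccSlots)
    (hsteep₂ : ⟪A₂ u₂, EuclideanSpace.single (2 : Fin 3) (1 : ℝ)⟫_ℝ ≤ -(Real.sqrt 2 / 2))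
    (κ : List (EuclideanSpace ℝ (Fin 3)))
    (hκl : ∀ μ ∈ κ, ‖μ‖ = 1 ∧
      ∀ w ∈ fccSlots, ⟪w, μ⟫_ℝ = 0 ∨ ⟪w, μ⟫_ℝ = Real.sqrt (2 / 3) ∨ ⟪w, μ⟫_ℝ = -Real.sqrt (2 / 3))
    (hκc : List.IsChain (fun μ μ' => ⟪μ, μ'⟫_ℝ = 1 / 3 ∨ ⟪μ, μ'⟫_ℝ = -1 / 3) κ) (hκ2 : 2 ≤ κ.length)
    (hA₁ : A₁ '' fccStacking 1 (Real.sqrt (2 / 3)) = (wordFrame A₂ κ) '' fccStacking 1 (Real.sqrt (2 / 3)))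
    (hfirst : ∀ μ, κ.getLast? = some μ → ⟪u₂, μ⟫_ℝ = 0) :
    GenericWallFloorAtCharge (1 / 2) A₁ t₁ A₂ t₂ :=
  genericWallFloorAtHalf_oneSidedDown_of_far hs₀ hcert hfar A₁ t₁ A₂ t₂ hu₂ hsteep₂
    {F | ∃ stk : List WalkEntry, StackSound (-EuclideanSpace.single (2 : Fin 3) (1 : ℝ)) stk ∧
      StackWF (-EuclideanSpace.single (2 : Fin 3) (1 : ℝ)) stk ∧ stk.getLast? = some ⟨A₂, u₂, 0⟩ ∧ ∃ e ∈ stk, e.frame = F}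
    (fun stk hS hW hlast e he => ⟨stk, hS, hW, hlast, e, he, rfl⟩)
    (fun _ ⟨_, hS, hW, hl, _, he, hF⟩ => by rw [← hF]; exact image_ne_of_word κ hκl hκc hκ2 hA₁ hfirst hS hW hl he)

end Summit.Ventures.Crystal3D.Theorems

end
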